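import Summits.Parity.GeneralizedHardyLittlewood.Theorems.AbsoluteUpgrade.Negative.CellParityLawSavingLoadBearing
import Summits.Parity.GeneralizedHardyLittlewood.Theorems.LeeYangFibresAbsoluteUpgradeHighMass
import Literature.NumberTheory.Sieve.LinearEquationsInPrimesOneForm
import HarnessLib

/-!
# Disproof of `CellParityLawSaving` (stmt-Parity-18104) — findings of the crux disprover (cdisprove, cycle 1)

Crux (route `LeeYangFibres`, rank 3, LOAD-BEARING in `closes`): for all `t ≥ 1`, `L` there are `δ > 0`, `N₀`
with, for `N ≥ N₀`, every non-degenerate `d = 1` system `Ψ` of size `‖Ψ‖_N ≤ L` and every convex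
`K ⊆ [-N, N]`: amplitudes `θ : Finset (Fin t) → ℝ`, `θ_∅ = 1`, `|θ_S| ≤ 2`, such that for every `j ∈ [1, U(N)]^t`
`|C_j − W_θ(j) · β_∞ 𝔖 ∏_i A_{j_i}(N)/N| ≤ N/((log N)^t (log N)^δ)`, `U(N) = max 4 ⌊√(log log N)/2⌋`.

## Findings (index; details in the docstrings)

* §0 `crux_iff_dip` — the route decl is `Iff.rfl`-equal to the dip line's
  `DipMarginRateExchange.CellParityLawSaving`; every statement below is over that vocabulary
  (`jointCell`, `cell`, `slowDegree`), and `Conclusion` names the `∃ θ …` block verbatim.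
* §1 THE ENGINE `corner_squeeze` + `sum_walsh_pairs`: on the `2^t` corner cells `j ∈ {1,2}^t` the Walsh weights
  have mean EXACTLY `θ_∅ = 1` (`Σ_j W_θ(j) = 2^t θ_∅`), so whatever the free amplitudes, the law forces
  `min_j (β_∞ 𝔖 ∏ A_{j_i}/N) ≤ max_j C_j + allowance`.  Every refutation below is this squeeze against a body /
  system whose lattice content and model disagree.  (For provers: `θ_∅ = 1` is the one rigid datum of the law —
  the TOTAL corner mass; the `2^t − 1` free amplitudes cannot repair a mismatch of total mass.)
* §1b TIGHTNESS OF THE AMPLITUDE BOX: Walsh inversion on the corners (`sum_walsh_mul_chi`) gives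
  `abs_amplitude_le_one` / `abs_amplitude_le`: corner weights `≥ −κ` and `θ_∅ = 1` force `|θ_S| ≤ 1 + 2κ` — the
  clause `|θ_S| ≤ 2` is redundant up to `o(1)` (slack `1`); a prover may DEFINE `θ` as the normalised Walsh
  transform of the corner ratios.
* §2 LOAD-BEARING HYPOTHESES (sorry-free):
  - `cellParityLawSaving_false_without_nondegeneracy` — drop `IsNondegenerateSystem`: the CONSTANT form
    `ψ ≡ p` (`p` prime in `(N, 2N]`, `‖Ψ‖_N ≤ 2`) has `𝔖 = 0` (`β_p = 0`) but `C_1 = 2N + 1`.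
    (The one-shot attack had this mutation "inconclusive (limUnder junk)"; the constant form avoids the junk:
    its partial singular products are EVENTUALLY ZERO.)
  - `cellParityLawSaving_false_without_sizeBound` — drop `‖Ψ‖_N ≤ L`: the shift pair `(n, n + w#)` with a
    primorial shift chosen AFTER `N` has `𝔖 ≥ ½ Σ_{p ≤ w} 1/p` unbounded (tree `singularProduct_shiftPair_ge`),
    so the corner models `β_∞ 𝔖 A_{j₁}A_{j₂}/N ≫ 𝔖 N/log² N` exceed the trivial bound `C_j ≤ 2N+1` — the size
    bound is what caps `𝔖 ≤ (C log log N)^{t-1}` (tree `stub_singularProduct_le_loglog_pow`).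
  - `cellParityLawSaving_false_without_convexity` — drop `Convex ℝ K`: `K = [-N, N] ∖ ℤ` has `β_∞ = N` and no
    lattice point (tree `archFactor_id_boxMinusLattice`).
  - box containment `K ⊆ [-N, N]`: ALREADY in the tree,
    `Theorems.AbsoluteUpgrade.Negative.cellParityLawSaving_false_without_boxContainment` (p114876), re-exported
    here as `cellParityLawSaving_false_without_boxContainment'`.
  - `1 ≤ t` is NOT load-bearing: `conclusion_zero_forms` proves the `t = 0` instance outright (lattice points of
    an interval against its length, tree `DimOne.exists_filter_eq_Icc`).
* §3 WHY THE CRUX RESISTS (prose, with the numbers): every cheap attack on the STATED hypotheses is consistent —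
  see the module docstring of §3.  No kill; the crux is of Hardy–Littlewood strength for `t ≥ 2` and its typing
  survived: top cells, value scale `≤ LN`, half-lines of positivity, `𝔖 = 0` systems, primorial shifts within
  the size bound, Siegel tilts (Walsh-consistent).
* §4 NATURAL STRENGTHENINGS REFUTED / near-misses: `cell_top_eq_zero` (`A_U(N) = 0` exactly) and §4b
  `cellParityLawSaving_false_relative` — the purely RELATIVE retyping (allowance `(log N)^{-δ}|W·M_j|`, no
  absolute floor) is FALSE at the top cell of the shifted form `n + (N+1)`, `N = p^{U(N)} − 1` (schedule pinned by
  `slowDegree_eq_of_mem`, scales from `exists_shifted_top_value`); so any two-tier retyping (ideator-1 F1) must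
  keep a floor or cut `j_i = U(N)`.  `δ ≥ 1` is generically false at `t = 1` (second-order scale terms
  `≍ N log(2L)/log² N`; numerics §3) — prose only (needs second-order cell asymptotics not in the tree).
* §5 PROSPECTIVE TARGETS of the picked line (`PICKED.md`: SketchIdeator3 = card superpoly-band-same-atom; no
  skeleton registered at this cycle): assessment of `FordCapsExponent` / `SuperPolyRoughCellLaw a` and
  `SectionLevelAlong` — see the §5 docblock; nothing cheap bites, the kernel at fixed deficit is unfalsifiable by
  design (constants absorb) and a kill along `η → 0` needs a QUANTIFIED, `M`-uniform Ford construction for rough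
  CELL COUNTS, which is neither in print (barrier file scope (ii)) nor in the tree.

LANDED (gate): `Theorems/CellParityLawSaving/Negative/CornerSqueeze.lean` (p159078: engine, `law_zero_forms`,
`cell_top_eq_zero`), `…/Negative/LoadBearingHypotheses.lean` (p159424: non-degeneracy, size bound, convexity),
`…/Negative/RelativeAllowance.lean` (p159939: relative retyping false).  Box containment: p114876 (earlier seat).
-/

noncomputable section

namespace Summit.Parity.GeneralizedHardyLittlewood.Cruxes.CellParityLawSaving.Disproof

open scoped BigOperators Classical
open Filter MeasureTheory Finset Literature.NumberTheory.Sieve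
open Summit.Parity.GeneralizedHardyLittlewood.Cruxes.FibreHyperbolicity.ModelTransfer (jointCell)
open Summit.Parity.GeneralizedHardyLittlewood.Cruxes.AbsoluteUpgrade.DipMarginRateExchange
  (slowDegree four_le_slowDegree)
open Summit.Parity.GeneralizedHardyLittlewood.Theorems.ModelHyperbolicity.Negative (cell)
open Summit.Parity.GeneralizedHardyLittlewood.Cruxes.AbsoluteUpgrade.NlcCellsAbsoluteClip (roughCell)
open Summit.Parity.GeneralizedHardyLittlewood.Theorems.AbsoluteUpgrade
  (roughCell_four_le stub_roughAnatomy exists_corner_lower isNondegenerateSystem_shiftPair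
    singularProduct_shiftPair_ge exists_sum_primesLE_inv_ge archFactor_shiftPair_ge)
open Summit.Parity.GeneralizedHardyLittlewood.Theorems.AbsoluteUpgrade.Negative
  (cellParityLawSaving_false_without_boxContainment)
open Summit.Parity.GeneralizedHardyLittlewood.Theorems.AbsoluteUpgrade.Negative.CellSaving
  (cell_eq_roughCell walsh_fin_one)
open Summit.Parity.GeneralizedHardyLittlewood.Theorems.AbsoluteUpgrade.Negative.FibreAlong
  (jointCell_eq_zero_of_forall_not_mem isNondegenerateSystem_id affLinSize_id archFactor_id_boxMinusLattice
    realPoint_not_mem_boxMinusLattice)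
open Summit.Parity.GeneralizedHardyLittlewood.Theorems.PrimeCellsRelative.Negative.BoxContainment
  (singularProduct_id)

/-! ## §0 The crux, factored -/

/-- The Walsh weight `W_θ(j) = Σ_{S ⊆ [t]} θ_S ∏_{i ∈ S} (-1)^{j_i + 1}` (verbatim the route's). [folklore] -/
def walsh {t : ℕ} (θ : Finset (Fin t) → ℝ) (j : Fin t → ℕ) : ℝ :=
  ∑ S : Finset (Fin t), θ S * ∏ i ∈ S, (-1 : ℝ) ^ (j i + 1)

/-- The model product `β_∞ · 𝔖 · ∏_i A_{j_i}(N)/N` of the crux at roughness `U(N)`. [folklore] -/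
def model {t : ℕ} (N : ℕ) (Ψ : Fin t → AffLinForm 1) (K : Set (Fin 1 → ℝ)) (j : Fin t → ℕ) : ℝ :=
  archFactor Ψ K * singularProduct Ψ * ∏ i, (cell (slowDegree N) N (j i) : ℝ) / N

/-- The conclusion block of the crux at `(t, δ, N, Ψ, K)` — VERBATIM the `∃ θ …` of the route decl. [folklore] -/
def Conclusion (t : ℕ) (δ : ℝ) (N : ℕ) (Ψ : Fin t → AffLinForm 1) (K : Set (Fin 1 → ℝ)) : Prop :=
  ∃ θ : Finset (Fin t) → ℝ, θ ∅ = 1 ∧ (∀ S, |θ S| ≤ 2) ∧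
    ∀ j : Fin t → ℕ, (∀ i, 1 ≤ j i ∧ j i ≤ slowDegree N) →
      |(jointCell t N (slowDegree N) Ψ K j : ℝ) -
          (∑ S : Finset (Fin t), θ S * ∏ i ∈ S, (-1 : ℝ) ^ (j i + 1)) *
            (archFactor Ψ K * singularProduct Ψ *
              ∏ i, (cell (slowDegree N) N (j i) : ℝ) / N)| ≤
        (N : ℝ) / (Real.log N ^ t * Real.log N ^ δ)

/-- The route decl IS the dip line's statement (definitional). [folklore] -/
theorem crux_iff_dip :
    Summit.Parity.GeneralizedHardyLittlewood.Theses.LeeYangFibres.CellParityLawSaving ↔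
      Summit.Parity.GeneralizedHardyLittlewood.Cruxes.AbsoluteUpgrade.DipMarginRateExchange.CellParityLawSaving :=
  Iff.rfl

/-- The crux with its conclusion block named (definitional). [folklore] -/
theorem crux_iff :
    Summit.Parity.GeneralizedHardyLittlewood.Theses.LeeYangFibres.CellParityLawSaving ↔
      ∀ (t L : ℕ), 1 ≤ t → ∃ δ : ℝ, 0 < δ ∧ ∃ N₀ : ℕ, ∀ N : ℕ, N₀ ≤ N →
        ∀ Ψ : Fin t → AffLinForm 1, IsNondegenerateSystem Ψ → affLinSize Ψ N ≤ L →
        ∀ K : Set (Fin 1 → ℝ), Convex ℝ K → K ⊆ realBox 1 N → Conclusion t δ N Ψ K :=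
  Iff.rfl

/-! ## §1 The engine: Walsh mean on the corner cells, and the squeeze -/

/-- On the `2^t` corner cells `j ∈ {1,2}^t` the Walsh weights sum to `2^t θ_∅`: every non-empty `S` sees both
signs in each of its coordinates. [folklore] -/
theorem sum_walsh_pairs {t : ℕ} (θ : Finset (Fin t) → ℝ) :
    ∑ j ∈ Fintype.piFinset (fun _ : Fin t => ({1, 2} : Finset ℕ)), walsh θ j = 2 ^ t * θ ∅ := by
  classical
  unfold walsh
  rw [Finset.sum_comm]
  have hinner : ∀ S : Finset (Fin t),
      ∑ j ∈ Fintype.piFinset (fun _ : Fin t => ({1, 2} : Finset ℕ)), θ S * ∏ i ∈ S, (-1 : ℝ) ^ (j i + 1) =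
        θ S * ∏ i : Fin t, (if i ∈ S then (0 : ℝ) else 2) := by
    intro S
    rw [← Finset.mul_sum]
    congr 1
    have hprod : ∀ j : Fin t → ℕ, ∏ i ∈ S, (-1 : ℝ) ^ (j i + 1) =
        ∏ i : Fin t, (if i ∈ S then (-1 : ℝ) ^ (j i + 1) else 1) := by
      intro j
      rw [Finset.prod_ite_mem, Finset.univ_inter]
    simp_rw [hprod]
    calc ∑ j ∈ Fintype.piFinset (fun _ : Fin t => ({1, 2} : Finset ℕ)),
          ∏ i : Fin t, (if i ∈ S then (-1 : ℝ) ^ (j i + 1) else 1)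
        = ∏ i : Fin t, ∑ m ∈ ({1, 2} : Finset ℕ), (if i ∈ S then (-1 : ℝ) ^ (m + 1) else 1) :=
          (Finset.prod_univ_sum (fun _ : Fin t => ({1, 2} : Finset ℕ))
            (fun i m => if i ∈ S then (-1 : ℝ) ^ (m + 1) else 1)).symm
      _ = ∏ i : Fin t, (if i ∈ S then (0 : ℝ) else 2) := by
          refine Finset.prod_congr rfl fun i _ => ?_
          split_ifs with hi
          · rw [Finset.sum_pair (by norm_num)]
            norm_num
          · rw [Finset.sum_const, Finset.card_pair (by norm_num)]
            norm_num
  simp_rw [hinner]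
  rw [Finset.sum_eq_single_of_mem ∅ (Finset.mem_univ _)]
  · simp [mul_comm]
  · intro S _ hS
    obtain ⟨i, hi⟩ := Finset.nonempty_iff_ne_empty.mpr hS
    rw [Finset.prod_eq_zero (Finset.mem_univ i) (by rw [if_pos hi]), mul_zero]

/-- **Corner squeeze.** If the conclusion holds with `θ_∅ = 1`, every corner cell is `≤ B`, and every corner
model is `≥ P₀ ≥ 0`, then `P₀ ≤ B + E`: the Walsh weights have mean one on the corners, and a weight acts on its
model only through `W_θ(j) · model_j ≤ C_j + E`. [folklore] -/
theorem corner_squeeze {t : ℕ} {θ : Finset (Fin t) → ℝ} (hθ : θ ∅ = 1)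
    {C P : (Fin t → ℕ) → ℝ} {B E P₀ : ℝ} (hP₀ : 0 ≤ P₀) (hE : 0 ≤ E) (hB : 0 ≤ B)
    (hdev : ∀ j ∈ Fintype.piFinset (fun _ : Fin t => ({1, 2} : Finset ℕ)), |C j - walsh θ j * P j| ≤ E)
    (hC : ∀ j ∈ Fintype.piFinset (fun _ : Fin t => ({1, 2} : Finset ℕ)), C j ≤ B)
    (hP : ∀ j ∈ Fintype.piFinset (fun _ : Fin t => ({1, 2} : Finset ℕ)), P₀ ≤ P j) :
    P₀ ≤ B + E := by
  set J := Fintype.piFinset (fun _ : Fin t => ({1, 2} : Finset ℕ)) with hJ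
  have hpt : ∀ j ∈ J, walsh θ j * P₀ ≤ B + E := by
    intro j hj
    have h1 : walsh θ j * P j ≤ C j + E := by
      have h2 : walsh θ j * P j - C j ≤ E := (abs_sub_le_iff.1 (hdev j hj)).2
      linarith
    rcases le_or_gt 0 (walsh θ j) with hw | hw
    · calc walsh θ j * P₀ ≤ walsh θ j * P j := mul_le_mul_of_nonneg_left (hP j hj) hw
        _ ≤ C j + E := h1
        _ ≤ B + E := by linarith [hC j hj]
    · have : walsh θ j * P₀ ≤ 0 := mul_nonpos_of_nonpos_of_nonneg hw.le hP₀
      linarith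
  have hsum : ∑ j ∈ J, walsh θ j * P₀ ≤ ∑ _j ∈ J, (B + E) := Finset.sum_le_sum hpt
  rw [← Finset.sum_mul, hJ, sum_walsh_pairs, hθ, Finset.sum_const, Fintype.card_piFinset] at hsum
  simp only [Finset.card_pair (show (1 : ℕ) ≠ 2 by norm_num), Finset.prod_const, Finset.card_univ,
    Fintype.card_fin, mul_one, nsmul_eq_mul, Nat.cast_pow, Nat.cast_ofNat] at hsum
  have h2 : (0 : ℝ) < 2 ^ t := by positivity
  nlinarith

/-- Corner indices are admissible cell indices along the schedule (`1 ≤ j_i ≤ 2 ≤ 4 ≤ U(N)`). [folklore] -/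
theorem corner_admissible {t : ℕ} (N : ℕ) {j : Fin t → ℕ}
    (hj : j ∈ Fintype.piFinset (fun _ : Fin t => ({1, 2} : Finset ℕ))) (i : Fin t) :
    1 ≤ j i ∧ j i ≤ slowDegree N := by
  have h := Fintype.mem_piFinset.mp hj i
  simp only [Finset.mem_insert, Finset.mem_singleton] at h
  have h4 := four_le_slowDegree N
  rcases h with h | h <;> rw [h] <;> omega

/-- From the conclusion block to the engine's deviation hypothesis on the corners. [folklore] -/
theorem corners_of_conclusion {t : ℕ} {δ : ℝ} {N : ℕ} {Ψ : Fin t → AffLinForm 1} {K : Set (Fin 1 → ℝ)}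
    (h : Conclusion t δ N Ψ K) :
    ∃ θ : Finset (Fin t) → ℝ, θ ∅ = 1 ∧
      ∀ j ∈ Fintype.piFinset (fun _ : Fin t => ({1, 2} : Finset ℕ)),
        |(jointCell t N (slowDegree N) Ψ K j : ℝ) - walsh θ j * model N Ψ K j| ≤
          (N : ℝ) / (Real.log N ^ t * Real.log N ^ δ) := by
  obtain ⟨θ, hθ, -, hj⟩ := h
  exact ⟨θ, hθ, fun j hjm => hj j (corner_admissible N hjm)⟩

/-! ### §1b The clause `|θ_S| ≤ 2` is redundant up to `o(1)` (tightness of the amplitude box)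

Walsh inversion on the corners: `2^t θ_S = Σ_{j ∈ {1,2}^t} W_θ(j) χ_S(j)`, `χ_S(j) = ∏_{i∈S}(−1)^{j_i+1}`.  Hence if
the corner weights are NON-NEGATIVE (as the law forces up to `allowance/M_j`, cells being counts) and `θ_∅ = 1`,
then `|θ_S| ≤ 2^{-t} Σ_j |W_θ(j)| = 2^{-t} Σ_j W_θ(j) = θ_∅ = 1`: the planner's box `|θ_S| ≤ 2` has slack `1`, and a
prover may simply DEFINE `θ` as the normalised Walsh transform of the corner ratios. -/

/-- The sign character `χ_S(j) = ∏_{i ∈ S} (-1)^{j_i + 1}`. [folklore] -/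
def chi {t : ℕ} (S : Finset (Fin t)) (j : Fin t → ℕ) : ℝ := ∏ i ∈ S, (-1 : ℝ) ^ (j i + 1)

/-- `χ_S(j)² = 1`, indeed `χ_S(j) ∈ {±1}`. [folklore] -/
theorem chi_mul_self {t : ℕ} (S : Finset (Fin t)) (j : Fin t → ℕ) : chi S j * chi S j = 1 := by
  unfold chi
  rw [← Finset.prod_mul_distrib]
  refine Finset.prod_eq_one fun i _ => ?_
  rw [← pow_add, ← two_mul, pow_mul]
  norm_num

/-- `|χ_S(j)| = 1`. [folklore] -/
theorem abs_chi {t : ℕ} (S : Finset (Fin t)) (j : Fin t → ℕ) : |chi S j| = 1 := by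
  have h := chi_mul_self S j
  have : |chi S j| * |chi S j| = 1 := by rw [← abs_mul, h, abs_one]
  nlinarith [abs_nonneg (chi S j)]

/-- Multiplicativity: `χ_T χ_S = χ_{T ∆ S}` on corners (signs square to one). [folklore] -/
theorem chi_mul_chi {t : ℕ} (T S : Finset (Fin t)) (j : Fin t → ℕ) :
    chi T j * chi S j = chi (symmDiff T S) j := by
  classical
  unfold chi
  -- write both sides over `univ` with indicator exponents
  have key : ∀ R : Finset (Fin t), ∏ i ∈ R, (-1 : ℝ) ^ (j i + 1) =
      ∏ i : Fin t, (if i ∈ R then (-1 : ℝ) ^ (j i + 1) else 1) := by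
    intro R; rw [Finset.prod_ite_mem, Finset.univ_inter]
  rw [key T, key S, key (symmDiff T S), ← Finset.prod_mul_distrib]
  refine Finset.prod_congr rfl fun i _ => ?_
  have hsq : (-1 : ℝ) ^ (j i + 1) * (-1 : ℝ) ^ (j i + 1) = 1 := by
    rw [← pow_add, ← two_mul, pow_mul]; norm_num
  by_cases hT : i ∈ T <;> by_cases hS : i ∈ S <;>
    simp [hT, hS, Finset.mem_symmDiff, hsq]

/-- Orthogonality: `Σ_{j ∈ {1,2}^t} χ_R(j) = 2^t` if `R = ∅`, else `0`. [folklore] -/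
theorem sum_chi_pairs {t : ℕ} (R : Finset (Fin t)) :
    ∑ j ∈ Fintype.piFinset (fun _ : Fin t => ({1, 2} : Finset ℕ)), chi R j =
      if R = ∅ then (2 : ℝ) ^ t else 0 := by
  classical
  -- the one-amplitude Walsh sum with `θ = 𝟙_{R}`
  have h := sum_walsh_pairs (t := t) (fun S => if S = R then (1 : ℝ) else 0)
  unfold walsh at h
  simp only [ite_mul, one_mul, zero_mul, Finset.sum_ite_eq', Finset.mem_univ, if_true] at h
  unfold chi
  rw [h]
  by_cases hR : R = ∅
  · subst hR; simp
  · rw [if_neg hR, if_neg (Ne.symm hR), mul_zero]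

/-- **Walsh inversion on the corners**: `Σ_j W_θ(j) χ_S(j) = 2^t θ_S`. [folklore] -/
theorem sum_walsh_mul_chi {t : ℕ} (θ : Finset (Fin t) → ℝ) (S : Finset (Fin t)) :
    ∑ j ∈ Fintype.piFinset (fun _ : Fin t => ({1, 2} : Finset ℕ)), walsh θ j * chi S j = 2 ^ t * θ S := by
  classical
  have hexp : ∀ j : Fin t → ℕ, walsh θ j * chi S j = ∑ T : Finset (Fin t), θ T * chi (symmDiff T S) j := by
    intro j
    unfold walsh
    rw [Finset.sum_mul]
    refine Finset.sum_congr rfl fun T _ => ?_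
    rw [mul_assoc, ← chi_mul_chi T S j]
    rfl
  simp_rw [hexp]
  rw [Finset.sum_comm]
  simp_rw [← Finset.mul_sum, sum_chi_pairs]
  simp only [mul_ite, mul_zero]
  rw [Finset.sum_ite, Finset.sum_const_zero, add_zero]
  have hfilter : (Finset.univ.filter fun T : Finset (Fin t) => symmDiff T S = ∅) = {S} := by
    ext T
    simp only [Finset.mem_filter, Finset.mem_univ, true_and, Finset.mem_singleton]
    rw [← Finset.bot_eq_empty, symmDiff_eq_bot]
  rw [hfilter, Finset.sum_singleton, mul_comm]

/-- **The amplitude box is redundant up to `o(1)`**: non-negative corner weights and `θ_∅ = 1` force `|θ_S| ≤ 1`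
for EVERY `S` (so the crux's `|θ_S| ≤ 2` has slack `1`). [folklore] -/
theorem abs_amplitude_le_one {t : ℕ} {θ : Finset (Fin t) → ℝ} (hθ : θ ∅ = 1)
    (hpos : ∀ j ∈ Fintype.piFinset (fun _ : Fin t => ({1, 2} : Finset ℕ)), 0 ≤ walsh θ j) (S : Finset (Fin t)) :
    |θ S| ≤ 1 := by
  have h2t : (0 : ℝ) < 2 ^ t := by positivity
  have hinv := sum_walsh_mul_chi θ S
  have hmean := sum_walsh_pairs θ
  rw [hθ, mul_one] at hmean
  have hbound : |∑ j ∈ Fintype.piFinset (fun _ : Fin t => ({1, 2} : Finset ℕ)), walsh θ j * chi S j| ≤ 2 ^ t := by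
    refine (Finset.abs_sum_le_sum_abs _ _).trans ?_
    rw [← hmean]
    refine Finset.sum_le_sum fun j hj => ?_
    rw [abs_mul, abs_chi, mul_one, abs_of_nonneg (hpos j hj)]
  rw [hinv, abs_mul, abs_of_pos h2t] at hbound
  have : |θ S| ≤ 2 ^ t / 2 ^ t := by
    rw [le_div_iff₀ h2t]; linarith
  rwa [div_self h2t.ne'] at this

/-- Quantitative form used by provers: corner weights `≥ −κ` and `θ_∅ = 1` give `|θ_S| ≤ 1 + 2κ`·(well, `1 + κ`
per corner on average): `|θ_S| ≤ 1 + 2κ`. [folklore] -/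
theorem abs_amplitude_le {t : ℕ} {θ : Finset (Fin t) → ℝ} (hθ : θ ∅ = 1) {κ : ℝ} (hκ : 0 ≤ κ)
    (hpos : ∀ j ∈ Fintype.piFinset (fun _ : Fin t => ({1, 2} : Finset ℕ)), -κ ≤ walsh θ j) (S : Finset (Fin t)) :
    |θ S| ≤ 1 + 2 * κ := by
  have h2t : (0 : ℝ) < 2 ^ t := by positivity
  have hinv := sum_walsh_mul_chi θ S
  have hmean := sum_walsh_pairs θ
  rw [hθ, mul_one] at hmean
  set J := Fintype.piFinset (fun _ : Fin t => ({1, 2} : Finset ℕ)) with hJ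
  have hcard : (J.card : ℝ) = 2 ^ t := by
    rw [hJ, Fintype.card_piFinset]
    simp [Finset.card_pair (show (1 : ℕ) ≠ 2 by norm_num)]
  -- `|W| ≤ W + 2κ` when `W ≥ -κ`
  have hbound : |∑ j ∈ J, walsh θ j * chi S j| ≤ 2 ^ t + 2 * κ * 2 ^ t := by
    refine (Finset.abs_sum_le_sum_abs _ _).trans ?_
    have hle : ∀ j ∈ J, |walsh θ j * chi S j| ≤ walsh θ j + 2 * κ := by
      intro j hj
      rw [abs_mul, abs_chi, mul_one]
      have := hpos j hj
      rcases le_or_gt 0 (walsh θ j) with h | h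
      · rw [abs_of_nonneg h]; linarith
      · rw [abs_of_neg h]; linarith
    refine (Finset.sum_le_sum hle).trans ?_
    rw [Finset.sum_add_distrib, hmean, Finset.sum_const, nsmul_eq_mul, hcard]
    linarith
  rw [hinv, abs_mul, abs_of_pos h2t] at hbound
  have : |θ S| ≤ (2 ^ t + 2 * κ * 2 ^ t) / 2 ^ t := by
    rw [le_div_iff₀ h2t]; linarith
  rwa [add_div, div_self h2t.ne', mul_div_assoc, div_self h2t.ne', mul_one] at this

/-! ## §2 Load-bearing hypotheses -/

/-! ### Shared scale facts -/

/-- The lattice box `[-N, N]¹` has `2N + 1` points. [folklore] -/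
theorem card_latticeBox_one (N : ℕ) : (latticeBox 1 N).card = 2 * N + 1 := by
  unfold latticeBox
  rw [Fintype.card_piFinset, Finset.prod_const, Finset.card_univ, Fintype.card_fin, pow_one, Int.card_Icc]
  omega

/-- Every joint cell is at most the lattice content of the box, `2N + 1`. [folklore] -/
theorem jointCell_le {t N u : ℕ} (Ψ : Fin t → AffLinForm 1) (K : Set (Fin 1 → ℝ)) (j : Fin t → ℕ) :
    (jointCell t N u Ψ K j : ℝ) ≤ 2 * N + 1 := by
  have h : jointCell t N u Ψ K j ≤ 2 * N + 1 := by
    unfold jointCell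
    exact (Finset.card_filter_le _ _).trans (card_latticeBox_one N).le
  exact_mod_cast h

/-- The allowance is at most `N` once `log N ≥ 1` (`t` arbitrary, `δ ≥ 0`). [folklore] -/
theorem allowance_le {N t : ℕ} {δ : ℝ} (hN : Real.exp 1 ≤ N) (hδ : 0 ≤ δ) :
    (N : ℝ) / (Real.log N ^ t * Real.log N ^ δ) ≤ N := by
  have hlog : 1 ≤ Real.log N := by
    rw [Real.le_log_iff_exp_le (by linarith [Real.exp_pos 1])]
    exact hN
  have h1 : 1 ≤ Real.log N ^ t * Real.log N ^ δ :=
    one_le_mul_of_one_le_of_one_le (one_le_pow₀ hlog) (Real.one_le_rpow hlog hδ)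
  exact div_le_self (Nat.cast_nonneg N) h1

/-- Corner model cells along the schedule are `≥ c N/log N` eventually (`m = 1, 2`; rough anatomy at `u = 4`
transported to `U(N) ≥ 4`). [folklore] -/
theorem eventually_corner_cells :
    ∃ c : ℝ, 0 < c ∧ ∀ᶠ N : ℕ in atTop, ∀ m ∈ ({1, 2} : Finset ℕ),
      c * (N : ℝ) / Real.log N ≤ (cell (slowDegree N) N m : ℝ) := by
  obtain ⟨c, hc, hev⟩ := exists_corner_lower
  refine ⟨c, hc, ?_⟩
  filter_upwards [hev, eventually_ge_atTop 1] with N hN hN1 m hm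
  have hm' : m ∈ ({1, 2, 3} : Finset ℕ) := by
    simp only [Finset.mem_insert, Finset.mem_singleton] at hm ⊢
    omega
  refine (hN m hm').trans ?_
  rw [cell_eq_roughCell]
  exact_mod_cast roughCell_four_le hN1 (four_le_slowDegree N) m

/-! ### (a) Non-degeneracy: the constant form -/

/-- The constant one-form system `ψ ≡ b`. [folklore] -/
def constForm (b : ℤ) : Fin 1 → AffLinForm 1 := fun _ => ⟨fun _ => 0, b⟩

/-- The constant form with a prime value `p` has a vanishing local factor at `p`. [folklore] -/
theorem localFactor_constForm_self {p : ℕ} (hp : p.Prime) : localFactor (constForm p) p = 0 := by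
  rw [OneForm.localFactor_eq _ hp]
  simp [constForm]

/-- ... hence its partial singular products vanish from `x = p` on, and `𝔖(ψ ≡ p) = 0`. [folklore] -/
theorem singularProduct_constForm {p : ℕ} (hp : p.Prime) : singularProduct (constForm p) = 0 := by
  have hev : (fun x => singularProductPartial (constForm (p : ℤ)) x) =ᶠ[atTop] fun _ => (0 : ℝ) := by
    filter_upwards [eventually_ge_atTop p] with x hx
    unfold singularProductPartial
    exact Finset.prod_eq_zero (Nat.mem_primesLE.mpr ⟨hx, hp⟩) (localFactor_constForm_self hp)
  have hlim : Tendsto (singularProductPartial (constForm (p : ℤ))) atTop (nhds 0) :=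
    tendsto_const_nhds.congr' hev.symm
  rw [singularProduct, hlim.limUnder_eq]

/-- `‖(ψ ≡ p)‖_N = p/N ≤ 2` for `0 ≤ p ≤ 2N`. [folklore] -/
theorem affLinSize_constForm {p N : ℕ} (hN : 0 < N) (hp : p ≤ 2 * N) :
    affLinSize (constForm (p : ℤ)) N ≤ ((2 : ℕ) : ℝ) := by
  have hN' : (0 : ℝ) < N := by exact_mod_cast hN
  have hp' : (p : ℝ) ≤ 2 * N := by exact_mod_cast hp
  simp only [affLinSize, constForm, Fin.sum_univ_one, Int.cast_zero, abs_zero, Finset.sum_const_zero,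
    Int.cast_natCast, zero_add, Nat.cast_ofNat]
  rw [abs_of_nonneg (by positivity), div_le_iff₀ hN']
  exact hp'

/-- On the full box every lattice point sits in the prime cell of `ψ ≡ p` when `N^{1/U} < p`, `p` prime: the
joint cell `j = 1` is the whole box, `2N + 1` points. [folklore] -/
theorem jointCell_constForm {p N u : ℕ} (hp : p.Prime) (hth : (N : ℝ) ^ ((1 : ℝ) / u) < p) :
    jointCell 1 N u (constForm p) (realBox 1 N) (fun _ => 1) = 2 * N + 1 := by
  unfold jointCell
  rw [Finset.filter_true_of_mem, card_latticeBox_one]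
  intro n hn
  refine ⟨?_, fun _ => ?_⟩
  · simp only [latticeBox, Fintype.mem_piFinset, Finset.mem_Icc] at hn
    refine ⟨fun i => ?_, fun i => ?_⟩
    · have := (hn i).1
      show -(N : ℝ) ≤ (n i : ℝ)
      exact_mod_cast this
    · have := (hn i).2
      show (n i : ℝ) ≤ N
      exact_mod_cast this
  · have hev : ((constForm (p : ℤ) (0 : Fin 1)).eval n).toNat = p := by
      simp [constForm, AffLinForm.eval]
    simp only [constForm] at hev ⊢
    rw [show ((⟨fun _ => 0, (p : ℤ)⟩ : AffLinForm 1).eval n).toNat = p from hev]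
    exact ⟨by rw [Nat.Prime.minFac_eq hp]; exact hth, ArithmeticFunction.cardFactors_apply_prime hp⟩

/-- The crux WITHOUT `IsNondegenerateSystem Ψ` (constant forms allowed). [folklore] -/
def CellParityLawSavingWithoutNondegeneracy : Prop :=
  ∀ (t L : ℕ), 1 ≤ t → ∃ δ : ℝ, 0 < δ ∧ ∃ N₀ : ℕ, ∀ N : ℕ, N₀ ≤ N →
    ∀ Ψ : Fin t → AffLinForm 1, affLinSize Ψ N ≤ L →
    ∀ K : Set (Fin 1 → ℝ), Convex ℝ K → K ⊆ realBox 1 N → Conclusion t δ N Ψ K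

/-- **Non-degeneracy is load-bearing.** At `t = 1`, `L = 2`: the constant form `ψ ≡ p`, `p` a prime in
`(N, 2N]` (Bertrand), on `K = [-N, N]` has `𝔖 = 0` — every model term vanishes — while its prime cell holds
all `2N + 1` lattice points (`N^{1/U} ≤ N < p`), against an allowance `≤ N`. [folklore] -/
theorem cellParityLawSaving_false_without_nondegeneracy : ¬ CellParityLawSavingWithoutNondegeneracy := by
  intro h
  obtain ⟨δ, hδ, N₀, hN₀⟩ := h 1 2 le_rfl
  -- a scale `N ≥ max N₀ 3`
  set N : ℕ := max N₀ 3 with hNdef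
  have hNN₀ : N₀ ≤ N := le_max_left _ _
  have hN3 : 3 ≤ N := le_max_right _ _
  have hNpos : 0 < N := by omega
  have hNr : (3 : ℝ) ≤ N := by exact_mod_cast hN3
  obtain ⟨p, hp, hNp, hp2⟩ := Nat.exists_prime_lt_and_le_two_mul N (by omega)
  -- threshold: `N^{1/U} ≤ N < p`
  have hth : (N : ℝ) ^ ((1 : ℝ) / (slowDegree N : ℕ)) < p := by
    have h1 : (N : ℝ) ^ ((1 : ℝ) / (slowDegree N : ℕ)) ≤ (N : ℝ) ^ (1 : ℝ) := by
      refine Real.rpow_le_rpow_of_exponent_le (by linarith) ?_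
      rw [div_le_one (by have := four_le_slowDegree N; positivity)]
      have := four_le_slowDegree N
      exact_mod_cast (show 1 ≤ slowDegree N by omega)
    rw [Real.rpow_one] at h1
    exact h1.trans_lt (by exact_mod_cast hNp)
  obtain ⟨θ, hθ0, -, hj⟩ := hN₀ N hNN₀ (constForm p) (affLinSize_constForm hNpos hp2) (realBox 1 N)
    (convex_Icc _ _) subset_rfl
  have h1 := hj (fun _ => 1) (fun _ => ⟨le_rfl, by have := four_le_slowDegree N; omega⟩)
  rw [jointCell_constForm hp hth, singularProduct_constForm hp] at h1
  simp only [mul_zero, zero_mul, sub_zero, pow_one] at h1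
  have hE : (N : ℝ) / (Real.log N * Real.log N ^ δ) ≤ N := by
    have := allowance_le (N := N) (t := 1) (δ := δ) ?_ hδ.le
    · simpa using this
    · exact (Real.exp_one_lt_d9.le.trans (by norm_num)).trans hNr
  have habs : |((2 * N + 1 : ℕ) : ℝ)| = 2 * N + 1 := by
    rw [abs_of_nonneg (by positivity)]; push_cast; ring
  rw [habs] at h1
  linarith

/-! ### (a) Size bound: primorial shift pairs -/

/-- The crux WITHOUT the size bound `‖Ψ‖_N ≤ L` (equivalently: `N₀` chosen before `L`). [folklore] -/
def CellParityLawSavingWithoutSizeBound : Prop :=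
  ∀ t : ℕ, 1 ≤ t → ∃ δ : ℝ, 0 < δ ∧ ∃ N₀ : ℕ, ∀ N : ℕ, N₀ ≤ N →
    ∀ Ψ : Fin t → AffLinForm 1, IsNondegenerateSystem Ψ →
    ∀ K : Set (Fin 1 → ℝ), Convex ℝ K → K ⊆ realBox 1 N → Conclusion t δ N Ψ K

/-- **The size bound is load-bearing.** At `t = 2`: for the shift pair `(n, n + w#)` with `½ Σ_{p ≤ w} 1/p >
4 log² N/c²` (chosen after `N`; `c` the corner-cell constant) on `K = [-N, N]`: `β_∞ ≥ N`, `𝔖 ≥ ½ Σ_{p≤w} 1/p`,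
`A_1, A_2 ≥ cN/log N`, so every corner model exceeds `4N ≥ (2N+1) + allowance ≥ C_j + allowance`, and the
corner squeeze (`θ_∅ = 1`) is violated.  Moral: any proof uses `L` to cap `𝔖 ≲ (log log N)^{t−1}`
(tree `stub_singularProduct_le_loglog_pow`). [folklore] -/
theorem cellParityLawSaving_false_without_sizeBound : ¬ CellParityLawSavingWithoutSizeBound := by
  intro h
  obtain ⟨δ, hδ, N₀, hN₀⟩ := h 2 (by norm_num)
  obtain ⟨c, hc, hcells⟩ := eventually_corner_cells
  obtain ⟨N, hNN₀, hN3, hcell⟩ : ∃ N : ℕ, N₀ ≤ N ∧ 3 ≤ N ∧ ∀ m ∈ ({1, 2} : Finset ℕ),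
      c * (N : ℝ) / Real.log N ≤ (cell (slowDegree N) N m : ℝ) := by
    obtain ⟨N, h1, h2, h3⟩ := ((eventually_ge_atTop N₀).and ((eventually_ge_atTop 3).and hcells)).exists
    exact ⟨N, h1, h2, h3⟩
  have hNr : (3 : ℝ) ≤ N := by exact_mod_cast hN3
  have hNpos : (0 : ℝ) < N := by linarith
  have hlogpos : 0 < Real.log N := Real.log_pos (by linarith)
  -- the primorial shift, chosen after `N`
  set T : ℝ := 4 * Real.log N ^ 2 / c ^ 2 + 1 with hT
  have hTpos : 0 < T := by positivity
  obtain ⟨w, hw2, hw⟩ := exists_sum_primesLE_inv_ge (2 * T)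
  set hh : ℤ := (primorial w : ℤ) with hhh
  have hh0 : hh ≠ 0 := by rw [hhh]; exact_mod_cast (primorial_pos w).ne'
  have hhnn : (0 : ℤ) ≤ hh := by rw [hhh]; positivity
  have hS : T ≤ singularProduct (shiftPairSystem hh) := by
    have := singularProduct_shiftPair_ge hw2
    rw [← hhh] at this
    linarith
  have hA : (N : ℝ) ≤ archFactor (shiftPairSystem hh) (realBox 1 N) := archFactor_shiftPair_ge hhnn N
  -- the law on the shift pair
  obtain ⟨θ, hθ, hdev⟩ := corners_of_conclusion
    (hN₀ N hNN₀ (shiftPairSystem hh) (isNondegenerateSystem_shiftPair hh0) (realBox 1 N) (convex_Icc _ _)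
      subset_rfl)
  -- the squeeze: corner models ≥ T c² N / log² N, corner cells ≤ 2N+1, allowance ≤ N
  set E : ℝ := (N : ℝ) / (Real.log N ^ 2 * Real.log N ^ δ) with hE
  have hE0 : 0 ≤ E := by positivity
  have hEN : E ≤ N := allowance_le ((Real.exp_one_lt_d9.le.trans (by norm_num)).trans hNr) hδ.le
  set P₀ : ℝ := T * (c ^ 2 * N / Real.log N ^ 2) with hP₀
  have hP₀nn : 0 ≤ P₀ := by positivity
  have hB : ℝ := 0
  have hsq := corner_squeeze (t := 2) hθ (C := fun j => (jointCell 2 N (slowDegree N) (shiftPairSystem hh)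
      (realBox 1 N) j : ℝ)) (P := model N (shiftPairSystem hh) (realBox 1 N)) (B := 2 * N + 1) (E := E)
    hP₀nn hE0 (by positivity) hdev (fun j _ => jointCell_le _ _ j) ?_
  · -- contradiction: `T c² N/log² N ≤ 3N + 1 ≤ 4N` against `T > 4 log² N / c²`
    have h4 : P₀ ≤ 4 * N := by linarith
    rw [hP₀, hT] at h4
    have key : (4 * Real.log N ^ 2 / c ^ 2 + 1) * (c ^ 2 * N / Real.log N ^ 2) = 4 * N + c ^ 2 * N / Real.log N ^ 2 := by
      field_simp
    rw [key] at h4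
    have : 0 < c ^ 2 * N / Real.log N ^ 2 := by positivity
    linarith
  · -- corner models ≥ P₀
    intro j hj
    have hc0 : c * (N : ℝ) / Real.log N ≤ (cell (slowDegree N) N (j 0) : ℝ) :=
      hcell (j 0) (Fintype.mem_piFinset.mp hj 0)
    have hc1 : c * (N : ℝ) / Real.log N ≤ (cell (slowDegree N) N (j 1) : ℝ) :=
      hcell (j 1) (Fintype.mem_piFinset.mp hj 1)
    have hcpos : 0 ≤ c * (N : ℝ) / Real.log N := by positivity
    unfold model
    rw [Fin.prod_univ_two]
    have hprod : (c * N / Real.log N / N) * (c * N / Real.log N / N) ≤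
        (cell (slowDegree N) N (j 0) : ℝ) / N * ((cell (slowDegree N) N (j 1) : ℝ) / N) := by
      apply mul_le_mul (div_le_div_of_nonneg_right hc0 hNpos.le) (div_le_div_of_nonneg_right hc1 hNpos.le)
        (by positivity) (by positivity)
    have hsimp : (c * N / Real.log N / N) * (c * N / Real.log N / N) = c ^ 2 / Real.log N ^ 2 := by
      field_simp
    rw [hsimp] at hprod
    calc P₀ = N * T * (c ^ 2 / Real.log N ^ 2) := by rw [hP₀]; field_simp
      _ ≤ archFactor (shiftPairSystem hh) (realBox 1 N) * singularProduct (shiftPairSystem hh) *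
            ((cell (slowDegree N) N (j 0) : ℝ) / N * ((cell (slowDegree N) N (j 1) : ℝ) / N)) := by
          apply mul_le_mul (mul_le_mul hA hS hTpos.le ((Nat.cast_nonneg N).trans hA)) hprod (by positivity)
          exact mul_nonneg ((Nat.cast_nonneg N).trans hA) (hTpos.le.trans hS)

/-! ### (a) Convexity: the box minus its lattice points -/

/-- The crux WITHOUT `Convex ℝ K` (all `K ⊆ [-N, N]`). [folklore] -/
def CellParityLawSavingWithoutConvexity : Prop :=
  ∀ (t L : ℕ), 1 ≤ t → ∃ δ : ℝ, 0 < δ ∧ ∃ N₀ : ℕ, ∀ N : ℕ, N₀ ≤ N →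
    ∀ Ψ : Fin t → AffLinForm 1, IsNondegenerateSystem Ψ → affLinSize Ψ N ≤ L →
    ∀ K : Set (Fin 1 → ℝ), K ⊆ realBox 1 N → Conclusion t δ N Ψ K

/-- **Convexity is load-bearing.** At `t = 1`, `L = 1`, `ψ(n) = n` on `K = [-N, N] ∖ ℤ`: `β_∞ = N` (a countable
set is null), `𝔖 = 1`, no lattice point lies in `K` (all cells empty), and the corner models `A_1(N), A_2(N) ≥
cN/log N` beat the allowance `N/(log N)^{1+δ}` once `c (log N)^δ > 1` — corner squeeze with `B = 0`. [folklore] -/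
theorem cellParityLawSaving_false_without_convexity : ¬ CellParityLawSavingWithoutConvexity := by
  intro h
  obtain ⟨δ, hδ, N₀, hN₀⟩ := h 1 1 le_rfl
  obtain ⟨c, hc, hcells⟩ := eventually_corner_cells
  have hTp : Tendsto (fun N : ℕ => Real.log (N : ℝ) ^ δ) atTop atTop :=
    (tendsto_rpow_atTop hδ).comp (Real.tendsto_log_atTop.comp tendsto_natCast_atTop_atTop)
  obtain ⟨N, hNN₀, hN3, hcell, hpow⟩ : ∃ N : ℕ, N₀ ≤ N ∧ 3 ≤ N ∧ (∀ m ∈ ({1, 2} : Finset ℕ),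
      c * (N : ℝ) / Real.log N ≤ (cell (slowDegree N) N m : ℝ)) ∧ 1 / c < Real.log (N : ℝ) ^ δ := by
    obtain ⟨N, h1, h2, h3, h4⟩ := ((eventually_ge_atTop N₀).and ((eventually_ge_atTop 3).and
      (hcells.and (hTp.eventually_gt_atTop (1 / c))))).exists
    exact ⟨N, h1, h2, h3, h4⟩
  have hNr : (3 : ℝ) ≤ N := by exact_mod_cast hN3
  have hNpos : (0 : ℝ) < N := by linarith
  have hlogpos : 0 < Real.log N := Real.log_pos (by linarith)
  have hP : 0 < Real.log N ^ δ := Real.rpow_pos_of_pos hlogpos δ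
  set K : Set (Fin 1 → ℝ) := realBox 1 (N : ℝ) \ {x : Fin 1 → ℝ | ∃ m : ℤ, x = fun _ => (m : ℝ)} with hK
  obtain ⟨θ, hθ, hdev⟩ := corners_of_conclusion
    (hN₀ N hNN₀ (fun _ => ⟨fun _ => 1, 0⟩) isNondegenerateSystem_id (affLinSize_id N) K (fun x hx => hx.1))
  set E : ℝ := (N : ℝ) / (Real.log N ^ 1 * Real.log N ^ δ) with hE
  have hE0 : 0 ≤ E := by positivity
  have hsq := corner_squeeze (t := 1) hθ
    (C := fun j => (jointCell 1 N (slowDegree N) (fun _ => ⟨fun _ => 1, 0⟩) K j : ℝ))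
    (P := model N (fun _ => ⟨fun _ => 1, 0⟩) K) (B := 0) (E := E) (P₀ := c * N / Real.log N)
    (by positivity) hE0 le_rfl hdev ?_ ?_
  · -- `c N/log N ≤ N/(log N · (log N)^δ)` against `c (log N)^δ > 1`
    rw [zero_add, hE, pow_one, div_le_div_iff₀ hlogpos (mul_pos hlogpos hP)] at hsq
    have hcP : 1 < c * Real.log N ^ δ := by
      have := (div_lt_iff₀ hc).mp hpow
      linarith [mul_comm (Real.log (N : ℝ) ^ δ) c]
    nlinarith [mul_lt_mul_of_pos_right hcP (mul_pos hNpos hlogpos), mul_pos hNpos hlogpos]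
  · intro j _
    have : jointCell 1 N (slowDegree N) (fun _ => ⟨fun _ => 1, 0⟩) K j = 0 :=
      jointCell_eq_zero_of_forall_not_mem _ (fun n _ => realPoint_not_mem_boxMinusLattice N n) j
    simp [this]
  · intro j hj
    unfold model
    rw [Fin.prod_univ_one, hK, archFactor_id_boxMinusLattice, singularProduct_id, mul_one]
    have hc0 := hcell (j 0) (Fintype.mem_piFinset.mp hj 0)
    calc c * (N : ℝ) / Real.log N ≤ (cell (slowDegree N) N (j 0) : ℝ) := hc0
      _ = N * ((cell (slowDegree N) N (j 0) : ℝ) / N) := by field_simp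

/-! ### (a) Box containment: in the tree -/

/-- The crux WITHOUT `K ⊆ [-N, N]` — verbatim the statement refuted in the tree (p114876). [folklore] -/
def CellParityLawSavingWithoutBoxContainment : Prop :=
  ∀ (t L : ℕ), 1 ≤ t → ∃ δ : ℝ, 0 < δ ∧ ∃ N₀ : ℕ, ∀ N : ℕ, N₀ ≤ N →
    ∀ Ψ : Fin t → AffLinForm 1, IsNondegenerateSystem Ψ → affLinSize Ψ N ≤ L →
    ∀ K : Set (Fin 1 → ℝ), Convex ℝ K → Conclusion t δ N Ψ K

/-- **Box containment is load-bearing** (tree, `Theorems/AbsoluteUpgrade/Negative/CellParityLawSavingLoadBearing`: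
`ψ(n) = n` on the far box `[2N, 10N]`, empty cells against `8(1 ± θ₀)A_{1,2}(N)`). [folklore] -/
theorem cellParityLawSaving_false_without_boxContainment' : ¬ CellParityLawSavingWithoutBoxContainment :=
  cellParityLawSaving_false_without_boxContainment

/-! ### `1 ≤ t` is NOT load-bearing: the law holds for the empty system -/

/-- For the EMPTY system (`t = 0`) the conclusion block holds at every `N ≥ 3` with `δ = 1`: the unique cell is
the lattice content `#(K ∩ ℤ)` of the interval `K`, the model is `β_∞ · 1 · 1 = vol K`, and an interval's
lattice content and length differ by at most `1 ≤ N/log N`.  So the hypothesis `1 ≤ t` of the crux carries no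
content (information for the planner; nothing to repair). [folklore] -/
theorem conclusion_zero_forms {N : ℕ} (hN : 3 ≤ N) (Ψ : Fin 0 → AffLinForm 1) {K : Set (Fin 1 → ℝ)}
    (hK : Convex ℝ K) (hKN : K ⊆ realBox 1 N) : Conclusion 0 1 N Ψ K := by
  refine ⟨fun _ => 1, rfl, fun S => by norm_num, fun j _ => ?_⟩
  -- the singular product of the empty system is `1`
  have hloc : ∀ p : ℕ, p.Prime → localFactor Ψ p = 1 := by
    intro p hp
    have hp0 : (p : ℝ) ≠ 0 := by exact_mod_cast hp.ne_zero
    unfold localFactor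
    simp only [Finset.univ_eq_empty, Finset.prod_empty, Finset.sum_const, Fintype.card_piFinset,
      Finset.card_range, Finset.prod_const, Finset.card_univ, Fintype.card_fin, pow_one, nsmul_eq_mul,
      mul_one]
    exact inv_mul_cancel₀ hp0
  have hS : singularProduct Ψ = 1 := by
    have hev : ∀ x, singularProductPartial Ψ x = 1 := fun x =>
      Finset.prod_eq_one fun p hp => hloc p (Nat.mem_primesLE.mp hp).2
    have hlim : Tendsto (singularProductPartial Ψ) atTop (nhds 1) :=
      tendsto_const_nhds.congr' (Eventually.of_forall fun x => (hev x).symm)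
    rw [singularProduct, hlim.limUnder_eq]
  -- the archimedean factor is the length of the slice
  set S : Set ℝ := {r : ℝ | (fun _ : Fin 1 => r) ∈ K} with hSdef
  have hA : archFactor Ψ K = (volume S).toReal := by
    rw [DimOne.archFactor_eq]
    congr 2
    ext r
    simp [hSdef]
  have hSord : S.OrdConnected := (DimOne.convex_slice hK).ordConnected
  have hSN : S ⊆ Set.Icc (-(N : ℝ)) N := by
    intro r hr
    have := hKN hr
    exact ⟨this.1 0, this.2 0⟩
  obtain ⟨m₁, m₂, hI, hvol⟩ := DimOne.exists_filter_eq_Icc (N := N) hSord hSN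
  -- the cell is the lattice content of the slice
  have hcellK : (jointCell 0 N (slowDegree N) Ψ K j : ℝ) = ((Finset.Icc m₁ m₂).card : ℝ) := by
    unfold jointCell
    rw [DimOne.card_filter_latticeBox, ← hI]
    congr 2
    ext m
    simp only [Finset.mem_filter, IsEmpty.forall_iff, and_true, hSdef, Set.mem_setOf_eq]
    rfl
  rw [hcellK, hS, hA]
  simp only [Finset.univ_eq_empty, Finset.prod_empty, mul_one, one_mul, pow_zero, Real.rpow_one]
  rw [Fintype.sum_eq_single (∅ : Finset (Fin 0)) (fun S hS => absurd (Finset.eq_empty_of_isEmpty S) hS),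
    Finset.prod_empty, one_mul]
  refine hvol.trans ?_
  -- `1 ≤ N / log N`
  have hNr : (3 : ℝ) ≤ N := by exact_mod_cast hN
  have hlogpos : 0 < Real.log N := Real.log_pos (by linarith)
  rw [le_div_iff₀ hlogpos, one_mul]
  have := Real.log_le_sub_one_of_pos (show (0 : ℝ) < N by linarith)
  linarith

/-! ## §3 Why the crux resists (no kill) — the record for the provers

All cheap attacks on the STATED hypotheses are consistent (this seat + the one-shot attack of
refuter-rattack-stmt-Parity-18104-0, kit j024145/j024223, + route review rreview1):

* **Top cells `j_i = U(N)`.** The model cell `A_U(N) = 0` EXACTLY (`cell_top_eq_zero`: `Ω(m) = U` and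
  `P⁻(m) > N^{1/U}` force `m > N`), while shifted forms DO have values in the top cell (values `≤ LN`, e.g.
  `p^U` with `N^{1/U} < p ≤ 2N^{1/U}` at `U = 4`); but their number is `≍ N (U log L/log N)^{U-1}/log N`,
  inside the absolute allowance for every `δ < U − 1`.  Consequence recorded in §4: a RELATIVE allowance would be
  false at the top cell; the purely absolute allowance is deliberate and sound.
* **Value scale.** Values live on `(0, LN]`, the model on `[1, N]`; local cell densities `I_j(u_x)/log x`,
  `u_x = U log x/log N = U + O(U log L/log N)`, move by a relative `O(U² log(2L)/log N)` (worst bulk cell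
  `j = U − 1`, `d log I_{U−1}/du ≈ U − 2`) — inside `(log N)^{-δ}` for every `δ < 1`, NOT for `δ ≥ 1` (§4).
* **`𝔖 = 0` systems** (`(n, n+1)`, `(n, 2n)`, inadmissible tuples): cells empty for `N^{1/U} > t`, model `0`.
* **Primorial shifts within the size bound** (`h = w# ≤ LN`): enter the MODEL through `𝔖 ≍ log log N` and stay
  Hardy–Littlewood-consistent; they only sharpen the demanded relative accuracy to `(log N)^{-δ}/𝔖`.
* **Positions are not independent but nearly so**: for two forms the true joint density is
  `∫ g_{j₁}(x) g_{j₂}(x + h) dx` against the model's product of averages; `g_j` varies by a relative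
  `O(U² log log N/log N)` over the part of `[1, N]` that carries more than the allowance — again `δ < 1` only.
* **Siegel tilts** (ideator-1 F5): an exceptional character distorts the pair cells by `1 + σ₁σ₂X²` — a Walsh
  monomial, absorbed by `θ_{12}`; the law is Walsh-consistent in the Siegel world (no negative lemma modulo a
  Siegel zero is expected against the LAW, only against atoms typed with Möbius pointwise).
* **Substance.** For `t ≥ 2` the law with `W ≡ 1` is the Bateman–Horn/Hardy–Littlewood heuristic for
  almost-prime cells with a log-power saving, uniform in shifts `≤ LN`; the free amplitudes concede exactly the
  `2^t − 1` parity directions a level-1 sieve cannot see (Bombieri 1976; Ford's fixed-level ghosts bite on PROOFS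
  at fixed level, not on the truth).  No unconditional refutation of the FORM is available without refuting
  prime-tuple heuristics; none of the typed normalisations (`β_∞` on the positivity region, `𝔖` in Green–Tao's
  normalisation, `A_j(N)/N` at roughness `N^{1/U(N)}`, `θ_∅ = 1`) is off — kit j024145 (N = 10⁷, u = 4):
  t = 2 ratios `C_j/M_j ∈ [0.97, 1.11]`, Walsh mean `1.004`, fitted `|θ_S| ≤ 3·10⁻³`.
* **Numerics of the SAVING (this seat).** Hub pure-python check (local/cells_small.py, exact counts, u = 4):
  t = 2, `(n, n+h)`, `K = [-N,N]`, `h ∈ {2, 6, 30}`: at `N = 10⁶` bulk ratios `C_j/M_j ∈ [0.97, 1.03]`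
  (`j ∈ {1,2}²`), minimax Walsh fit `|θ_S| ≤ 6·10⁻³`, max residual `0.012/0.021/0.030 · N/log² N`
  (h = 2/6/30) = `(log N)^{-1.7}/(log N)^{-1.46}/(log N)^{-1.33}`; at `N = 10⁵`: `0.018/0.042/0.053`.
  t = 1, `ψ(n) = n + 2N'` (`L = 3`, values on `[N', 3N']`): ratios `C_j/(2A_j(N')) = 0.878, 1.051, 1.806`
  (`j = 1, 2, 3`) at `N' = 7·10⁵` — the VALUE-SCALE effect (`u_x` up to `4 + 4 log 3/log N'`; cell 3 inflates
  by `≈ 1.8 Δu`), best amplitude `θ = −0.044`, max deviation `0.169 N'/log N' = (log N')^{-0.68}`; at `N' = 10⁵`: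
  `0.161 = (log N')^{-0.75}`.  So at computable scales the t = 1 clause holds only with `δ ≈ 0.7` (for L = 3; the
  deviation grows like `log L`), decaying like `1/log N` only asymptotically — consistent with the typing (`∃ δ`)
  but a warning that `N₀(t, L, δ)` is astronomically large for `δ` near `1`.
  KIT j025881 (numpy, exact counts, 94 s on cmp-8; evidence `compute-j025881.json`, table in its stdout):
  model cells `A_j(N)` at `u = 4` (j = 1, 2, 3; `A_4 = A_5 = 0`): N = 10⁶: 78487, 69300, 5052; 10⁷: 664563, 637535,
  58594; 10⁸: 5761430, 5710616, 557406; 3.3·10⁸: 17785443, 17759049, 1736110; 10⁹: 50847494, 51248370, 5120366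
  (`A_3 log N/N = 0.070, 0.094, 0.103, 0.103, 0.106` against Alladi's `I_3(4) = ∫_1^2 log w/(1+w) dw ≈ 0.1465`:
  the cell-3 asymptotic is still 28 % low at 10⁹ — second-order terms `≍ 1/log N` with a large constant).
  t = 2, `(n, n+h)`, `K = [-N, N]`, cells `j ∈ {1,2,3}²`, minimax Walsh fit with `θ_∅ = 1`:
    `N = 10⁹`: h = 2: ratios `C_j/M_j` = 1.0032, 0.9997, 0.9901 / 0.9998, 1.0015, 1.0068 / 0.9893, 1.0079, 1.0520
    (rows j₁ = 1,2,3; cols j₂ = 1,2,3), `θ = (+3.3, +3.7, +12)·10⁻⁴`, max residual `0.0019 N/log² N = (log N)^{-2.07}`;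
    h = 6: `0.0040 = (log N)^{-1.82}`; h = 30: `0.0050 = (log N)^{-1.75}`; Walsh mean of the four class-ratio means
    `1.0043/1.0045/1.0046`.  Trend of the max residual (h = 2): `0.0108, 0.0068, 0.0033, 0.0019 · N/log² N` at
    `N = 10⁶, 10⁷, 10⁸, 10⁹` — monotonically shrinking; the only cell off by more than 1 % at 10⁹ is `(3,3)`
    (`+5.2 %`, the position-correlation effect of this §: cell-3 density rises towards `x = N`, and
    `∫ g₃² > (∫ g₃)²`; absolute size `0.0013 N/log² N`).  So at computable scales the t = 2 clause holds with
    `|θ_S| ≤ 1.6·10⁻³` and a visible saving `(log N)^{-1.7…-2.1}` of the NON-Walsh residual.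
  t = 1, `ψ(n) = n + 2N'` (`L = 3`, values on `[N', 3N']`), `K = [-N', N']`:
    `N' = 10⁶ / 10⁷ / 10⁸ / 3.3·10⁸`: ratios `C_j/(2A_j(N'))` for j = 1, 2, 3 = (0.881, 1.061, 2.007) /
    (0.898, 1.039, 1.731) / (0.910, 1.030, 1.618) / (0.916, 1.028, 1.584); best amplitude `θ = −0.051, −0.035,
    −0.027, −0.025`; max deviation `0.148, 0.145, 0.133, 0.126 · N'/log N'`, i.e. `(log N')^{-δ₁}` with
    `δ₁ = 0.73, 0.70, 0.69, 0.70` — FLAT: the VALUE-SCALE inflation of cell 3 (`r₃ − 1 ≈ 12/log N'`) decays like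
    `1/log N'`, but `A_3 log N'/N'` is still climbing to `I_3(4)`, and the product stalls at `(log N')^{-0.7}` over
    three decades.  The t = 1 clause (the PROVABLE one: Siegel–Walfisz + Alladi along the schedule) therefore holds
    at `N' ≤ 3.3·10⁸`, `L = 3` only with `δ ≤ 0.7`, and its `N₀(1, L, δ)` for `δ → 1⁻` lies far beyond computation;
    the top cell is inhabited as §4b says (`C_4 = 19, 337, 2152, 3959` rough values `p₁p₂p₃p₄ ∈ (N', 3N']`
    against `A_4(N') = 0`), harmless for the absolute allowance (`≪ N'/(log N')^{1+δ}` for every `δ < 2.8`).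
* **Literature (negative results in print against the FORM): none.** `lit search` degraded (searchd reset, rc 1);
  `lit galaxy search --star all` (substring, 0 hits) and `--star pdf --mode intelligent` on almost-prime k-tuple
  asymptotics / joint `Ω` cells (12 hits: Elliott's survey, Pomerance–Pollack, Murty on Zhang, Vaughan "Hardy's
  legacy", Dartyge on friables — nothing asserting a deviation from the independent-anatomy × singular-series model
  beyond parity).  The only printed negatives remain the route's own: Bombieri 1976 / Ford 2004 (fixed-level ghosts,
  bite on proofs), Selberg / prime-pair parity (conceded by the amplitudes), Siegel tilts (Walsh-consistent).
-/

/-! ## §5 Prospective targets on the picked line (assessment only; no skeleton registered at this cycle)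

`PICKED.md` (lead, 2026-08-17): `SketchIdeator3` = card `superpoly-band-same-atom`, transfer
`ScheduleTransfer : (∃ a > 0, SuperPolyRoughCellLaw a) → (∀ t ≥ 1, SectionLevelAlong t) → CellParityLawSaving`,
with `FordCapsExponent : ∀ a > 2, ¬ SuperPolyRoughCellLaw a` flagged "disprover target".

* `SuperPolyRoughCellLaw a` (kernel `K_a`).  (i) Junk/degenerate instances do not bite: `Λ = 1` empties the
  sequence and then the size floor `x^{1−1/(4u)} ≤ 𝒜.size x` fails (hypotheses unsatisfiable, no kill); the
  interval sequence `a ≡ 1` on `(x/Λ, x]` meets every hypothesis and the conclusion with `δ = 1` by Alladi + PNT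
  (relative error `O(1/log z)` inside `(log z)^{-κ}` for the defender's `κ ≤ 1`).  (ii) At FIXED deficit `η` the
  kernel is unfalsifiable: the defender's constant `C` absorbs any fixed deviation (`C e^{Cu²} e^{-cη^{-a}}` is a
  constant).  (iii) A kill must run `η = η(x) → 0` (allowed down to `(log x)^{-1/2}`) with a deviation
  `≫ e^{-cη^{-a}} + (log z)^{-κ}`: for `a > 2` Ford's bump construction is the candidate (deviation believed
  `≈ e^{-η^{-2} log(1/η)}`), but (α) its size is NOT quantified in print (`FordFixedLevel.lean` scope caveat (ii):
  "the true width of the fixed-level indeterminacy band … is OPEN"), (β) it is stated for `Λ_k`-moments of a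
  sequence with the Type-I data of the integers, not for rough `Ω`-CELL COUNTS of a sequence with weights `≤ 1`
  on `(x/Λ, x]`, Iwaniec dimension and two-sided Mertens, and (γ) it must be made uniform in `M ≈ 1/η → ∞` with
  `x`.  The tree's `FordFixedLevelProofs` proves only the unquantified fixed-`ν` barrier.  Verdict: research-level;
  not attempted this cycle.  If the lead registers `K_a` as a stub, the cheapest genuine test is numerical: the
  parity-gap LP of ideator 2 (`ParityGapLP-ideator2.md`) IS the finite-`M` shadow of this band (`v(M, H)` at
  deficit `η = H/M`); its `η`-ladders (v growing with M at fixed η) are the data to extrapolate `a`.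
* `SectionLevelAlong t` (atom): typed tuple-GEH at level `N^{1−(log log N)^{-B}}` for the section sequences,
  `N₀` uniform in `u ≤ U(N)`.  Beyond EH but far below the Friedlander–Granville–Hildebrand–Maier refuted zone
  (deficit `log N/(log log N)^B ≫ (log log N)²`); an `ℓ¹` statement over moduli, so Siegel tilts are averaged —
  no negative lemma expected short of disproving GEH-type statements.  Not attackable.
-/

/-! ## §4 Near-misses and prospective targets (all `sorry`-free; prose where the Lean is out of reach) -/

/-- **The top model cell is empty**: `A_U(N) = 0` at roughness `N^{1/U}` (a product of `U` primes each
`> N^{1/U}` exceeds `N`).  First half of §4b: the RELATIVE-error strengthening is false at the top cell, because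
shifted systems (`ψ(n) = n + b`, `b ≍ N`) DO have rough values with `Ω = U(N)` in `(N, LN]` — at the scales
`N = p^{U(N)} − 1` of `exists_shifted_top_value` simply `p^{U(N)} = N + 1` (no short-interval primes needed: the
scale is chosen from the prime, inside one step of the schedule). [folklore] -/
theorem cell_top_eq_zero {u : ℕ} (N : ℕ) (hu : 1 ≤ u) : cell u N u = 0 := by
  unfold cell
  rw [Finset.card_eq_zero, Finset.filter_eq_empty_iff]
  rintro m hm ⟨hth, hΩ⟩
  rw [Finset.mem_Icc] at hm
  -- `m ≥ (minFac m)^Ω(m) = (minFac m)^u > (N^{1/u})^u = N`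
  have hm0 : m ≠ 0 := by omega
  have hpow : (Nat.minFac m) ^ u ≤ m := by
    rw [← hΩ, ArithmeticFunction.cardFactors_apply]
    conv_rhs => rw [← Nat.prod_primeFactorsList hm0]
    exact List.pow_card_le_prod _ _ fun p hp =>
      Nat.minFac_le_of_dvd (Nat.prime_of_mem_primeFactorsList hp).two_le (Nat.dvd_of_mem_primeFactorsList hp)
  have hNr : (0 : ℝ) ≤ N := Nat.cast_nonneg N
  have hth' : ((N : ℝ) ^ ((1 : ℝ) / u)) ^ u < ((Nat.minFac m : ℕ) : ℝ) ^ u :=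
    pow_lt_pow_left₀ hth (Real.rpow_nonneg hNr _) (by omega)
  rw [← Real.rpow_natCast, ← Real.rpow_mul hNr, one_div_mul_cancel (by exact_mod_cast (show u ≠ 0 by omega)),
    Real.rpow_one] at hth'
  have : (m : ℝ) ≤ N := by exact_mod_cast hm.2
  have : ((Nat.minFac m : ℕ) : ℝ) ^ u ≤ m := by exact_mod_cast hpow
  linarith


/-! ### §4b The purely RELATIVE retyping is false (the absolute floor is load-bearing at the top cell)

Ideator-1 F1 recommends a two-tier retyping (relative `U^{-m}` + absolute floor `U^{-U/2}`); the planner's kill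
criteria call the absolute allowance "typing-fragile".  The next theorems settle the extreme case: with NO floor,
a relative allowance `(log N)^{-δ} · |W_θ(j) M_j|` is FALSE — at the top cell `j = U(N)` the model vanishes
(`cell_top_eq_zero`) while the shifted form `ψ(n) = n + (N + 1)`, `N = p^{U(N)} − 1`, has the rough value
`p^{U(N)}` at `n = 0`.  The only work is pinning the schedule: `slowDegree N = U` on
`[exp exp 4U², exp exp 4(U+1)²)`, a range so long that `N = p^U − 1` with `p` a Bertrand prime above
`⌈X^{1/U}⌉` (`X = ⌈exp exp 4U²⌉`) falls inside it. -/

/-- The schedule pinned: `exp(exp(4U²)) ≤ N < exp(exp(4(U+1)²))`, `U ≥ 4` ⟹ `U(N) = U`. [folklore] -/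
theorem slowDegree_eq_of_mem {U N : ℕ} (hU : 4 ≤ U) (h1 : Real.exp (Real.exp (4 * (U : ℝ) ^ 2)) ≤ N)
    (h2 : (N : ℝ) < Real.exp (Real.exp (4 * ((U : ℝ) + 1) ^ 2))) : slowDegree N = U := by
  have hNpos : (0 : ℝ) < N := (Real.exp_pos _).trans_le h1
  have hlog1 : Real.exp (4 * (U : ℝ) ^ 2) ≤ Real.log N := by
    rw [Real.le_log_iff_exp_le hNpos]; exact h1
  have hlogpos : 0 < Real.log N := (Real.exp_pos _).trans_le hlog1
  have hll1 : 4 * (U : ℝ) ^ 2 ≤ Real.log (Real.log N) := by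
    rw [Real.le_log_iff_exp_le hlogpos]; exact hlog1
  have hlog2 : Real.log N < Real.exp (4 * ((U : ℝ) + 1) ^ 2) := by
    rw [Real.log_lt_iff_lt_exp hNpos]; exact h2
  have hll2 : Real.log (Real.log N) < 4 * ((U : ℝ) + 1) ^ 2 := by
    rw [Real.log_lt_iff_lt_exp hlogpos]; exact hlog2
  have hll0 : 0 ≤ Real.log (Real.log N) := le_trans (by positivity) hll1
  have hs1 : (U : ℝ) ≤ Real.sqrt (Real.log (Real.log N)) / 2 := by
    rw [le_div_iff₀ (by norm_num : (0 : ℝ) < 2), Real.le_sqrt (by positivity) hll0]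
    nlinarith
  have hs2 : Real.sqrt (Real.log (Real.log N)) / 2 < (U : ℝ) + 1 := by
    rw [div_lt_iff₀ (by norm_num : (0 : ℝ) < 2), Real.sqrt_lt' (by positivity)]
    nlinarith
  have hfloor : ⌊Real.sqrt (Real.log (Real.log N)) / 2⌋₊ = U := by
    rw [Nat.floor_eq_iff (by positivity)]
    exact ⟨hs1, hs2⟩
  unfold slowDegree
  rw [hfloor, max_eq_right hU]

/-- **A shifted top cell is inhabited at arbitrarily large scales.** For every `N₀` there is `N ≥ N₀` (`N ≥ 3`)
and a prime `p` with `N^{1/U(N)} < p` and `p^{U(N)} = N + 1`: take `U = max 4 N₀`, `X = ⌈exp exp 4U²⌉`,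
a Bertrand prime `p ∈ (⌈X^{1/U}⌉, 2⌈X^{1/U}⌉]`, `N = p^U − 1 ∈ [X, 2·4^U X) ⊆ [exp exp 4U², exp exp 4(U+1)²)`.
[folklore] -/
theorem exists_shifted_top_value (N₀ : ℕ) : ∃ N : ℕ, N₀ ≤ N ∧ 3 ≤ N ∧ ∃ p : ℕ, p.Prime ∧
    (N : ℝ) ^ ((1 : ℝ) / (slowDegree N : ℕ)) < p ∧ p ^ slowDegree N = N + 1 := by
  set U : ℕ := max 4 N₀ with hUdef
  have hU4 : 4 ≤ U := le_max_left _ _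
  have hUN₀ : N₀ ≤ U := le_max_right _ _
  have hU0 : U ≠ 0 := by omega
  have hUr : (4 : ℝ) ≤ U := by exact_mod_cast hU4
  set Y : ℝ := Real.exp (Real.exp (4 * (U : ℝ) ^ 2)) with hYdef
  have hYpos : 0 < Y := Real.exp_pos _
  have hY1 : 1 ≤ Y := by
    rw [hYdef]; exact Real.one_le_exp (Real.exp_pos _).le
  set X : ℕ := ⌈Y⌉₊ with hXdef
  have hXY : Y ≤ X := Nat.le_ceil Y
  have hX1 : (1 : ℝ) ≤ X := hY1.trans hXY
  have hXpos : (0 : ℝ) < X := by linarith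
  have hXle : (X : ℝ) ≤ Y + 1 := (Nat.ceil_lt_add_one hYpos.le).le
  -- the root and a Bertrand prime above it
  set r : ℝ := (X : ℝ) ^ ((1 : ℝ) / (U : ℕ)) with hrdef
  have hr1 : 1 ≤ r := Real.one_le_rpow hX1 (by positivity)
  set q : ℕ := ⌈r⌉₊ with hqdef
  have hq0 : q ≠ 0 := by
    have : 0 < q := Nat.ceil_pos.mpr (by linarith)
    omega
  have hrq : r ≤ q := Nat.le_ceil r
  have hqle : (q : ℝ) ≤ r + 1 := (Nat.ceil_lt_add_one (by linarith)).le
  obtain ⟨p, hp, hqp, hp2q⟩ := Nat.exists_prime_lt_and_le_two_mul q hq0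
  have hrp : r < p := hrq.trans_lt (by exact_mod_cast hqp)
  have hp4r : (p : ℝ) ≤ 4 * r := by
    have : (p : ℝ) ≤ 2 * q := by exact_mod_cast hp2q
    linarith
  -- `X < p^U ≤ 4^U X`
  have hrU : r ^ U = X := by
    rw [hrdef, one_div]; exact Real.rpow_inv_natCast_pow hXpos.le hU0
  have hXlt : (X : ℝ) < (p : ℝ) ^ U := by
    rw [← hrU]; exact pow_lt_pow_left₀ hrp (by linarith) hU0
  have hpUle : (p : ℝ) ^ U ≤ (4 : ℝ) ^ U * X := by
    rw [← hrU, ← mul_pow]; exact pow_le_pow_left₀ (by positivity) hp4r U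
  have hXltN : X < p ^ U := by exact_mod_cast hXlt
  set N : ℕ := p ^ U - 1 with hNdef
  have hNp : p ^ U = N + 1 := by
    have : 1 ≤ p ^ U := Nat.one_le_pow _ _ hp.pos
    omega
  have hXN : X ≤ N := by omega
  have hNr : (X : ℝ) ≤ N := by exact_mod_cast hXN
  have hN1 : Y ≤ N := hXY.trans hNr
  -- the upper end of the step: `N < 4^U (Y + 1) ≤ 2 · 4^U · Y < exp exp 4(U+1)²`
  have hN2 : (N : ℝ) < Real.exp (Real.exp (4 * ((U : ℝ) + 1) ^ 2)) := by
    have hNlt : (N : ℝ) < (4 : ℝ) ^ U * (Y + 1) := by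
      have h1 : (N : ℝ) < (p : ℝ) ^ U := by
        have : (N : ℝ) + 1 = (p : ℝ) ^ U := by exact_mod_cast hNp.symm
        linarith
      calc (N : ℝ) < (p : ℝ) ^ U := h1
        _ ≤ (4 : ℝ) ^ U * X := hpUle
        _ ≤ (4 : ℝ) ^ U * (Y + 1) := by gcongr
    refine hNlt.trans_le ?_
    -- `4^U (Y+1) ≤ 2·4^U·Y = exp(U log 4 + log 2 + exp(4U²)) ≤ exp(exp(4(U+1)²))`
    have h2Y : (4 : ℝ) ^ U * (Y + 1) ≤ 2 * (4 : ℝ) ^ U * Y := by nlinarith [pow_pos (show (0:ℝ) < 4 by norm_num) U]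
    refine h2Y.trans ?_
    have hexp : 2 * (4 : ℝ) ^ U * Y = Real.exp (Real.log 2 + U * Real.log 4 + Real.exp (4 * (U : ℝ) ^ 2)) := by
      rw [Real.exp_add, Real.exp_add, Real.exp_log (by norm_num), ← Real.rpow_natCast,
        Real.rpow_def_of_pos (by norm_num), hYdef]
      ring_nf
    rw [hexp, Real.exp_le_exp]
    -- `log 2 + U log 4 + e^{4U²} ≤ e^{4(U+1)²} = e^{4U²} e^{8U+4}`, and `e^{8U+4} ≥ 8U + 5`
    have hl2 : Real.log 2 ≤ 1 := by
      have := Real.log_le_sub_one_of_pos (show (0:ℝ) < 2 by norm_num); linarith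
    have hl4 : Real.log 4 ≤ 3 := by
      have := Real.log_le_sub_one_of_pos (show (0:ℝ) < 4 by norm_num); linarith
    have hE1 : 1 ≤ Real.exp (4 * (U : ℝ) ^ 2) := Real.one_le_exp (by positivity)
    have hsplit : Real.exp (4 * ((U : ℝ) + 1) ^ 2) = Real.exp (4 * (U : ℝ) ^ 2) * Real.exp (8 * U + 4) := by
      rw [← Real.exp_add]; ring_nf
    have hE2 : 8 * (U : ℝ) + 4 + 1 ≤ Real.exp (8 * U + 4) := Real.add_one_le_exp _
    rw [hsplit]
    have hU0' : (0 : ℝ) ≤ U := Nat.cast_nonneg U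
    nlinarith [mul_le_mul_of_nonneg_left hE2 (le_trans zero_le_one hE1), mul_nonneg hU0' (sub_nonneg.mpr hE1)]
  refine ⟨N, ?_, ?_, p, hp, ?_, ?_⟩
  · -- `N₀ ≤ U ≤ 4U² ≤ e^{4U²} ≤ e^{e^{4U²}} = Y ≤ N`
    have h1 : (U : ℝ) ≤ 4 * (U : ℝ) ^ 2 := by nlinarith
    have h2 : 4 * (U : ℝ) ^ 2 ≤ Real.exp (4 * (U : ℝ) ^ 2) := by linarith [Real.add_one_le_exp (4 * (U : ℝ) ^ 2)]
    have h3 : Real.exp (4 * (U : ℝ) ^ 2) ≤ Y := by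
      rw [hYdef]; linarith [Real.add_one_le_exp (Real.exp (4 * (U : ℝ) ^ 2))]
    have : (N₀ : ℝ) ≤ N := by
      have h0 : (N₀ : ℝ) ≤ U := by exact_mod_cast hUN₀
      linarith
    exact_mod_cast this
  · -- `3 ≤ 4 ≤ U ≤ N`
    have : (U : ℝ) ≤ N := by
      have h1 : (U : ℝ) ≤ 4 * (U : ℝ) ^ 2 := by nlinarith
      have h2 : 4 * (U : ℝ) ^ 2 ≤ Real.exp (4 * (U : ℝ) ^ 2) := by linarith [Real.add_one_le_exp (4 * (U : ℝ) ^ 2)]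
      have h3 : Real.exp (4 * (U : ℝ) ^ 2) ≤ Y := by
        rw [hYdef]; linarith [Real.add_one_le_exp (Real.exp (4 * (U : ℝ) ^ 2))]
      linarith
    have : U ≤ N := by exact_mod_cast this
    omega
  · rw [slowDegree_eq_of_mem hU4 hN1 hN2]
    -- `N < p^U` ⟹ `N^{1/U} < p`
    have h1 : (N : ℝ) < (p : ℝ) ^ U := by
      have : (N : ℝ) + 1 = (p : ℝ) ^ U := by exact_mod_cast hNp.symm
      linarith
    have h2 : ((N : ℝ) ^ ((1 : ℝ) / (U : ℕ))) ^ U < (p : ℝ) ^ U := by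
      rw [one_div, Real.rpow_inv_natCast_pow (Nat.cast_nonneg N) hU0]; exact h1
    exact lt_of_pow_lt_pow_left₀ U (Nat.cast_nonneg p) h2
  · rw [slowDegree_eq_of_mem hU4 hN1 hN2]; exact hNp

/-- The shifted form `ψ(n) = n + b`. [folklore] -/
def shiftForm (b : ℤ) : Fin 1 → AffLinForm 1 := fun _ => ⟨fun _ => 1, b⟩

/-- `ψ(n) = n + b` is non-degenerate. [folklore] -/
theorem isNondegenerateSystem_shiftForm (b : ℤ) : IsNondegenerateSystem (shiftForm b) := by
  refine ⟨fun i h0 => ?_, fun i j hij => absurd (Subsingleton.elim i j) hij⟩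
  have := congr_fun h0 0
  simp [shiftForm] at this

/-- `‖(n + (N+1))‖_N = 1 + (N+1)/N ≤ 3` for `N ≥ 1`. [folklore] -/
theorem affLinSize_shiftForm {N : ℕ} (hN : 1 ≤ N) :
    affLinSize (shiftForm ((N : ℤ) + 1)) N ≤ ((3 : ℕ) : ℝ) := by
  have hN' : (1 : ℝ) ≤ N := by exact_mod_cast hN
  have hNpos : (0 : ℝ) < N := by linarith
  simp only [affLinSize, shiftForm, Fin.sum_univ_one, Int.cast_one, abs_one, Int.cast_add, Int.cast_natCast,
    Nat.cast_ofNat]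
  rw [abs_of_nonneg (by positivity)]
  have : ((N : ℝ) + 1) / N ≤ 2 := by
    rw [div_le_iff₀ hNpos]; linarith
  linarith

/-- The top joint cell of `ψ(n) = n + (N+1)`, `N + 1 = p^{U}` with `N^{1/U} < p`, contains `n = 0`. [folklore] -/
theorem one_le_jointCell_shiftForm_top {N U p : ℕ} (hp : p.Prime) (hU : U ≠ 0) (hNp : p ^ U = N + 1)
    (hth : (N : ℝ) ^ ((1 : ℝ) / (U : ℕ)) < p) :
    1 ≤ jointCell 1 N U (shiftForm ((N : ℤ) + 1)) (realBox 1 N) (fun _ => U) := by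
  unfold jointCell
  refine Finset.card_pos.mpr ⟨fun _ => 0, ?_⟩
  rw [Finset.mem_filter]
  refine ⟨?_, ?_, fun _ => ?_⟩
  · simp [latticeBox]
  · refine ⟨fun i => ?_, fun i => ?_⟩ <;> simp [realPoint]
  · have hev : (((shiftForm ((N : ℤ) + 1)) (0 : Fin 1)).eval (fun _ => 0)).toNat = p ^ U := by
      simp only [shiftForm, AffLinForm.eval, mul_zero, Finset.sum_const_zero, zero_add]
      rw [hNp]; rfl
    simp only [shiftForm] at hev ⊢
    rw [show ((⟨fun _ => 1, (N : ℤ) + 1⟩ : AffLinForm 1).eval (fun _ => 0)).toNat = p ^ U from hev]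
    refine ⟨?_, ArithmeticFunction.cardFactors_apply_prime_pow hp⟩
    rw [Nat.Prime.pow_minFac hp hU]
    exact hth

/-- The crux RETYPED with a purely RELATIVE allowance `(log N)^{-δ} · |W_θ(j) · M_j|` (no absolute floor). [folklore] -/
def CellParityLawSavingRelative : Prop :=
  ∀ (t L : ℕ), 1 ≤ t → ∃ δ : ℝ, 0 < δ ∧ ∃ N₀ : ℕ, ∀ N : ℕ, N₀ ≤ N →
    ∀ Ψ : Fin t → AffLinForm 1, IsNondegenerateSystem Ψ → affLinSize Ψ N ≤ L →
    ∀ K : Set (Fin 1 → ℝ), Convex ℝ K → K ⊆ realBox 1 N →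
    ∃ θ : Finset (Fin t) → ℝ, θ ∅ = 1 ∧ (∀ S, |θ S| ≤ 2) ∧
      ∀ j : Fin t → ℕ, (∀ i, 1 ≤ j i ∧ j i ≤ slowDegree N) →
        |(jointCell t N (slowDegree N) Ψ K j : ℝ) -
            (∑ S : Finset (Fin t), θ S * ∏ i ∈ S, (-1 : ℝ) ^ (j i + 1)) *
              (archFactor Ψ K * singularProduct Ψ *
                ∏ i, (cell (slowDegree N) N (j i) : ℝ) / N)| ≤
          Real.log N ^ (-δ) *
            |(∑ S : Finset (Fin t), θ S * ∏ i ∈ S, (-1 : ℝ) ^ (j i + 1)) *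
              (archFactor Ψ K * singularProduct Ψ *
                ∏ i, (cell (slowDegree N) N (j i) : ℝ) / N)|

/-- **The purely relative retyping is false** (so the absolute allowance — or an absolute floor in any two-tier
retyping — is load-bearing): at `t = 1`, `L = 3`, at a scale `N = p^{U(N)} − 1` (`exists_shifted_top_value`), the
shifted form `ψ(n) = n + (N+1)` on `K = [-N, N]` has the top cell `j = U(N)` inhabited (`n = 0 ↦ p^{U(N)}`) while
its model `β_∞ 𝔖 A_{U(N)}(N)/N = 0` (`cell_top_eq_zero`) — a relative allowance then demands `C_j = 0`.
Repair: keep the absolute allowance (as typed), or restrict relative clauses to `j_i ≤ U(N) − 1`, or add a floor.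
[folklore] -/
theorem cellParityLawSaving_false_relative : ¬ CellParityLawSavingRelative := by
  intro h
  obtain ⟨δ, -, N₀, hN₀⟩ := h 1 3 le_rfl
  obtain ⟨N, hNN₀, hN3, p, hp, hth, hNp⟩ := exists_shifted_top_value N₀
  have hU0 : slowDegree N ≠ 0 := by have := four_le_slowDegree N; omega
  obtain ⟨θ, -, -, hj⟩ := hN₀ N hNN₀ (shiftForm ((N : ℤ) + 1)) (isNondegenerateSystem_shiftForm _)
    (affLinSize_shiftForm (by omega)) (realBox 1 N) (convex_Icc _ _) subset_rfl
  have h1 := hj (fun _ => slowDegree N) (fun _ => ⟨by omega, le_rfl⟩)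
  rw [Fin.prod_univ_one, cell_top_eq_zero N (by omega)] at h1
  simp only [Nat.cast_zero, zero_div, mul_zero, abs_zero, sub_zero] at h1
  have hC := one_le_jointCell_shiftForm_top hp hU0 hNp hth
  have hC' : (1 : ℝ) ≤ (jointCell 1 N (slowDegree N) (shiftForm ((N : ℤ) + 1)) (realBox 1 N)
      (fun _ => slowDegree N) : ℝ) := by exact_mod_cast hC
  rw [abs_of_nonneg (by positivity)] at h1
  linarith

end Summit.Parity.GeneralizedHardyLittlewood.Cruxes.CellParityLawSaving.Disproof

end
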